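import Summits.QuantumFields.YangMills.Theorems.UnitScaleTiltProp7LatticeBoxPoincareCov
import Summits.QuantumFields.YangMills.Theorems.UnitScaleTiltProp7LatticeBoxPotentialAlgebra
import HarnessLib

/-!
# LANE II (B9-gen) — THE COVARIANT POINCARÉ INEQUALITY ON A CUBE OF ANY SIDE (ℤᵈ letters)

Item stmt-QuantumFields-19200 (`MinimiserStabilityRegPr`), LANE II «divergence recovery at curved `W`»; ★p1 g19 NAMER WORD №11 (2)(a) («h7 ⊕ h8 in ℤᵈ box
letters, block-tiled box») and px4 g7's parity remark: blocks and block-cubes have side `L^k` resp. `m·L^k`, EVEN when `L` is even, whereas ✓(B9)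
`Prop7LatticeBoxPoincareCov.sum_sq_sub_mean_le_box_cov` lives on the odd boxes `box z R`.  This file re-issues (B9) on the cube
`Q(lo, n) := Fintype.piFinset (fun i => Finset.Icc (lo i) (lo i + n))` of side `n + 1` (ANY parity; written INLINE, no definition), by the chart
`r ↦ lo + r` onto lit ✓`poincare_coordCube (n d)`:
* §1 the chart (`cubeChart_mem/injective`, `exists_cubeChart_eq`, `cube_eq_image_cubeChart`, `sum_cube_eq_sum_chart`, `card_cube_eq`, `cubeChart_stepUp`,
  `ne_last_iff_add_unitVec_mem_cube`) and a support-shift lemma `sum_shift_le_of_support` for ANY finite set;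
* §2 ★`sum_sq_sub_avg_le_cube` (real): `Σ_Q(u − avg)² ≤ (n(n+1)∕2)·Σ_QΣ_μ[y+e_μ∈Q](u(y+e_μ) − u y)²`;
* §3 ★`sum_sq_sub_mean_le_cube_matrix` (plain mean, factor `N`); §4 ★★`sum_sq_sub_mean_le_cube_cov` (small bonds `‖T − 1‖ ≤ β`); §5 ★★`…_cube_plaq` (from `PlaqSmall`).  Pen px4 g7; rung R3 brick; YM gap NOT claimed.
-/

open scoped BigOperators Matrix.Norms.L2Operator
open Finset

namespace Summit.QuantumFields.YangMills.Theorems.Prop7LatticeCubePoincareCov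

open Literature.MathematicalPhysics.QuantumFieldTheory.Balaban1983to89
open Literature.MathematicalPhysics.QuantumFieldTheory.Balaban1983to89.B4Eq19LatticeOperators
open Literature.MathematicalPhysics.QuantumFieldTheory.Balaban1983to89.Beta.CoordCubePoincare (stepUp poincare_coordCube)
open Literature.MathematicalPhysics.QuantumFieldTheory.Balaban1983to89.Beta.BlockPoincare (avg)
open B7Prop1Explicit (U1 gaugeAct axialFn gaugeAct_mem l1)
open B7Eq78Linearization (conjR conjR_apply conjR_sub)
open B8Ineq132 (norm_conjR)
open B8Lemma1NonAbelian (PlaqSmall lowPart axial_bond_bound_sharp)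
open Summit.QuantumFields.YangMills.Theorems.Prop7LatticeBoxPotentialAlgebra (mem_U1_of_mem_unitaryUnits)
open Summit.QuantumFields.YangMills.Theorems.Prop7CovariantCoercivity (opNorm_sq_le_sum_re_sq_add_im_sq sum_re_sq_add_im_sq_le_mul_opNorm_sq sum_sum_sum_comm)
open Summit.QuantumFields.YangMills.Theorems.Prop7LatticeBoxFriedrichsCov (norm_conjR_sub_self_le)

variable {d N : ℕ}

/-! ## §1 The chart of a cube and a support-shift lemma -/

section Chart

variable (lo : Zd d) (n : ℕ)

/-- Membership in the cube `Q(lo,n)`. [folklore] [cite: Giaquinta1984, Ch. III §1 p.64] -/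
theorem mem_cube_iff {y : Zd d} : y ∈ Fintype.piFinset (fun i => Finset.Icc (lo i) (lo i + n)) ↔ ∀ i, lo i ≤ y i ∧ y i ≤ lo i + n := by
  rw [Fintype.mem_piFinset]
  exact forall_congr' fun i => by rw [Finset.mem_Icc]

/-- The chart lands in the cube. [folklore] [cite: Giaquinta1984, Ch. III §1 p.64] -/
theorem cubeChart_mem (r : Fin d → Fin (n + 1)) : (fun i => lo i + ((r i : ℕ) : ℤ)) ∈ Fintype.piFinset (fun i => Finset.Icc (lo i) (lo i + n)) := by
  rw [mem_cube_iff]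
  intro i
  have h0 : (0 : ℤ) ≤ ((r i : ℕ) : ℤ) := by positivity
  have h1 : ((r i : ℕ) : ℤ) ≤ n := by exact_mod_cast Nat.lt_succ_iff.mp (r i).isLt
  constructor <;> linarith

/-- The chart is injective. [folklore] [cite: Giaquinta1984, Ch. III §1 p.64] -/
theorem cubeChart_injective : Function.Injective (fun (r : Fin d → Fin (n + 1)) (i : Fin d) => lo i + ((r i : ℕ) : ℤ)) := by
  intro r r' h
  funext i
  have := congrFun h i
  simp only at this
  exact Fin.ext (by exact_mod_cast (add_left_cancel this))

/-- The chart is onto the cube. [folklore] [cite: Giaquinta1984, Ch. III §1 p.64] -/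
theorem exists_cubeChart_eq {y : Zd d} (hy : y ∈ Fintype.piFinset (fun i => Finset.Icc (lo i) (lo i + n))) :
    ∃ r : Fin d → Fin (n + 1), (fun i => lo i + ((r i : ℕ) : ℤ)) = y := by
  rw [mem_cube_iff] at hy
  refine ⟨fun i => ⟨(y i - lo i).toNat, ?_⟩, ?_⟩
  · have h0 := (hy i).1
    have h1 := (hy i).2
    zify
    rw [Int.toNat_of_nonneg (by linarith)]
    linarith
  · funext i
    simp only
    rw [Int.toNat_of_nonneg (by linarith [(hy i).1])]
    ring

/-- The cube is the image of the chart. [folklore] [cite: Giaquinta1984, Ch. III §1 p.64] -/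
theorem cube_eq_image_cubeChart [DecidableEq (Zd d)] :
    Fintype.piFinset (fun i => Finset.Icc (lo i) (lo i + n)) = Finset.univ.image (fun (r : Fin d → Fin (n + 1)) (i : Fin d) => lo i + ((r i : ℕ) : ℤ)) := by
  ext y
  simp only [Finset.mem_image, Finset.mem_univ, true_and]
  constructor
  · exact fun hy => exists_cubeChart_eq lo n hy
  · rintro ⟨r, rfl⟩; exact cubeChart_mem lo n r

/-- **Cube sums are chart sums.** [folklore] [cite: Giaquinta1984, Ch. III §1 p.64] -/
theorem sum_cube_eq_sum_chart {α : Type*} [AddCommMonoid α] (G : Zd d → α) :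
    ∑ y ∈ Fintype.piFinset (fun i => Finset.Icc (lo i) (lo i + n)), G y = ∑ r : Fin d → Fin (n + 1), G (fun i => lo i + ((r i : ℕ) : ℤ)) := by
  classical
  rw [cube_eq_image_cubeChart lo n, Finset.sum_image fun r _ r' _ h => cubeChart_injective lo n h]

/-- The cardinality of the cube. [folklore] [cite: Giaquinta1984, Ch. III §1 p.64] -/
theorem card_cube_eq : (Fintype.piFinset (fun i => Finset.Icc (lo i) (lo i + n))).card = (n + 1) ^ d := by
  classical
  rw [cube_eq_image_cubeChart lo n, Finset.card_image_of_injective _ (cubeChart_injective lo n)]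
  simp

/-- A step inside the chart is a unit step in the cube. [folklore] [cite: Giaquinta1984, Ch. III §1 p.64] -/
theorem cubeChart_stepUp (r : Fin d → Fin (n + 1)) (μ : Fin d) (hr : r μ ≠ Fin.last n) :
    (fun i => lo i + (((stepUp r μ) i : ℕ) : ℤ)) = (fun i => lo i + ((r i : ℕ) : ℤ)) + unitVec μ := by
  funext i
  simp only [stepUp, Pi.add_apply, unitVec, Pi.single_apply]
  by_cases hi : i = μ
  · subst hi
    rw [Function.update_self, if_pos rfl]
    have h1 : ((r i + 1 : Fin (n + 1)) : ℕ) = (r i : ℕ) + 1 := Fin.val_add_one_of_lt (Fin.lt_last_iff_ne_last.mpr hr)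
    rw [h1]; push_cast; ring
  · rw [Function.update_of_ne hi, if_neg hi, add_zero]

/-- Inside steps of the chart are exactly the cube steps that stay in the cube. [folklore] [cite: Giaquinta1984, Ch. III §1 p.64] -/
theorem ne_last_iff_add_unitVec_mem_cube (r : Fin d → Fin (n + 1)) (μ : Fin d) :
    r μ ≠ Fin.last n ↔ (fun i => lo i + ((r i : ℕ) : ℤ)) + unitVec μ ∈ Fintype.piFinset (fun i => Finset.Icc (lo i) (lo i + n)) := by
  constructor
  · intro hr
    rw [← cubeChart_stepUp lo n r μ hr]
    exact cubeChart_mem lo n _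
  · intro hmem hr
    have h := ((mem_cube_iff lo n).1 hmem μ).2
    simp only [Pi.add_apply, unitVec, Pi.single_eq_same, hr, Fin.val_last] at h
    linarith

end Chart

/-- **Support shift on any finite set**: if `H ≥ 0` vanishes off `S`, then `Σ_{y∈S} H(y+v) ≤ Σ_{y∈S} H y`. [folklore] -/
theorem sum_shift_le_of_support [DecidableEq (Zd d)] (S : Finset (Zd d)) {H : Zd d → ℝ} (hH0 : ∀ y, 0 ≤ H y) (hH : ∀ y ∉ S, H y = 0) (v : Zd d) :
    ∑ y ∈ S, H (y + v) ≤ ∑ y ∈ S, H y := by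
  let emb : Zd d ↪ Zd d := ⟨fun y => y + v, fun a b h => by simpa using h⟩
  have h1 : ∑ y ∈ S, H (y + v) = ∑ y ∈ S.map emb, H y := by rw [Finset.sum_map]; rfl
  rw [h1]
  calc ∑ y ∈ S.map emb, H y ≤ ∑ y ∈ S.map emb ∪ S, H y := Finset.sum_le_sum_of_subset_of_nonneg Finset.subset_union_left fun y _ _ => hH0 y
    _ = ∑ y ∈ S, H y := by
        rw [← Finset.sum_sdiff (Finset.subset_union_right (s₁ := S.map emb) (s₂ := S))]
        rw [Finset.sum_eq_zero (fun y hy => hH y (Finset.mem_sdiff.1 hy).2), zero_add]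

/-! ## §2 The flat `ℓ²` Poincaré inequality on a cube (real-valued) -/

/-- ★ **FLAT CUBE POINCARÉ, REAL, ANY SIDE**: `Σ_Q(u − avg)² ≤ (n(n+1)∕2)·Σ_QΣ_μ [y+e_μ ∈ Q]·(u(y+e_μ) − u y)²`, `Q = Q(lo,n)`, `avg` = lit `BlockPoincare.avg Q u`.
[cite: Balaban1983RegularityDecay, (2.27) p.580; Giaquinta1984, Ch. III §1 p.65] -/
theorem sum_sq_sub_avg_le_cube (lo : Zd d) (n : ℕ) (u : Zd d → ℝ) :
    ∑ y ∈ Fintype.piFinset (fun i => Finset.Icc (lo i) (lo i + n)), (u y - avg (Fintype.piFinset (fun i => Finset.Icc (lo i) (lo i + n))) u) ^ 2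
      ≤ (n : ℝ) * (n + 1) / 2 * ∑ y ∈ Fintype.piFinset (fun i => Finset.Icc (lo i) (lo i + n)), ∑ μ,
          (if y + unitVec μ ∈ Fintype.piFinset (fun i => Finset.Icc (lo i) (lo i + n)) then (u (y + unitVec μ) - u y) ^ 2 else 0) := by
  classical
  set Q := Fintype.piFinset (fun i => Finset.Icc (lo i) (lo i + (n : ℤ))) with hQ
  set φ : (Fin d → Fin (n + 1)) → Zd d := fun r i => lo i + ((r i : ℕ) : ℤ) with hφ
  have havg : avg Q u = avg Finset.univ (u ∘ φ) := by
    unfold avg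
    rw [hQ, sum_cube_eq_sum_chart lo n u, card_cube_eq lo n]
    simp [hφ]
  have hL : ∑ y ∈ Q, (u y - avg Q u) ^ 2 = ∑ r : Fin d → Fin (n + 1), ((u ∘ φ) r - avg Finset.univ (u ∘ φ)) ^ 2 := by
    rw [havg, hQ, sum_cube_eq_sum_chart lo n]
    rfl
  have hRside : ∑ y ∈ Q, ∑ μ, (if y + unitVec μ ∈ Q then (u (y + unitVec μ) - u y) ^ 2 else 0)
      = ∑ μ : Fin d, ∑ r ∈ Finset.univ.filter (fun r : Fin d → Fin (n + 1) => r μ ≠ Fin.last n), ((u ∘ φ) (stepUp r μ) - (u ∘ φ) r) ^ 2 := by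
    rw [hQ, sum_cube_eq_sum_chart lo n (fun y => ∑ μ, (if y + unitVec μ ∈ Fintype.piFinset (fun i => Finset.Icc (lo i) (lo i + (n : ℤ)))
      then (u (y + unitVec μ) - u y) ^ 2 else 0)), Finset.sum_comm]
    refine Finset.sum_congr rfl fun μ _ => ?_
    rw [Finset.sum_filter]
    refine Finset.sum_congr rfl fun r _ => ?_
    by_cases hr : r μ ≠ Fin.last n
    · rw [if_pos hr, if_pos ((ne_last_iff_add_unitVec_mem_cube lo n r μ).1 hr)]
      simp only [Function.comp_def, hφ]
      rw [cubeChart_stepUp lo n r μ hr]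
    · rw [if_neg hr, if_neg (fun h => hr ((ne_last_iff_add_unitVec_mem_cube lo n r μ).2 h))]
  have hP := poincare_coordCube n d (u ∘ φ)
  rw [hL, hRside]
  exact hP

/-! ## §3 Matrix-valued functions: the plain mean -/

/-- A real coordinate of the plain mean over any finite set is the mean of the coordinate. [folklore] -/
theorem coord_mean_finset (S : Finset (Zd d)) (w : Zd d → Matrix (Fin N) (Fin N) ℂ) (c : Matrix (Fin N) (Fin N) ℂ →+ ℝ)
    (hc : ∀ (t : ℝ) (A : Matrix (Fin N) (Fin N) ℂ), c ((t : ℂ) • A) = t * c A) :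
    c (((S.card : ℝ) : ℂ)⁻¹ • ∑ y ∈ S, w y) = avg S (fun y => c (w y)) := by
  unfold avg
  rw [← Complex.ofReal_inv, hc, map_sum, div_eq_inv_mul]

/-- ★ **FLAT CUBE POINCARÉ FOR `M_N(ℂ)`-VALUED FUNCTIONS, PLAIN MEAN, ANY SIDE**: `Σ_Q‖w y − m‖² ≤ N·(n(n+1)∕2)·Σ_QΣ_μ [y+e_μ ∈ Q]·‖w(y+e_μ) − w y‖²`,
`m = |Q|⁻¹·Σ_Q w`. [cite: Balaban1983RegularityDecay, (2.27) p.580; Giaquinta1984, Ch. III §1 p.65] -/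
theorem sum_sq_sub_mean_le_cube_matrix (lo : Zd d) (n : ℕ) (w : Zd d → Matrix (Fin N) (Fin N) ℂ) :
    ∑ y ∈ Fintype.piFinset (fun i => Finset.Icc (lo i) (lo i + n)),
        ‖w y - (((Fintype.piFinset (fun i => Finset.Icc (lo i) (lo i + n))).card : ℝ) : ℂ)⁻¹
          • ∑ x ∈ Fintype.piFinset (fun i => Finset.Icc (lo i) (lo i + n)), w x‖ ^ 2
      ≤ N * ((n : ℝ) * (n + 1) / 2) * ∑ y ∈ Fintype.piFinset (fun i => Finset.Icc (lo i) (lo i + n)), ∑ μ,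
          (if y + unitVec μ ∈ Fintype.piFinset (fun i => Finset.Icc (lo i) (lo i + n)) then ‖w (y + unitVec μ) - w y‖ ^ 2 else 0) := by
  classical
  set Q := Fintype.piFinset (fun i => Finset.Icc (lo i) (lo i + (n : ℤ))) with hQ
  set m : Matrix (Fin N) (Fin N) ℂ := (((Q.card : ℝ) : ℂ))⁻¹ • ∑ x ∈ Q, w x with hm
  set χ : Zd d → Fin d → ℝ := fun y μ => if y + unitVec μ ∈ Q then 1 else 0 with hχ
  have hχ0 : ∀ y μ, 0 ≤ χ y μ := fun y μ => by simp only [hχ]; split_ifs <;> norm_num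
  have hite : ∀ (y : Zd d) (μ : Fin d) (t : ℝ), (if y + unitVec μ ∈ Q then t else 0) = χ y μ * t := by
    intro y μ t; simp only [hχ]; split_ifs <;> simp
  have hcomp : ∀ (c : Matrix (Fin N) (Fin N) ℂ →+ ℝ), (∀ (t : ℝ) (A : Matrix (Fin N) (Fin N) ℂ), c ((t : ℂ) • A) = t * c A) →
      ∑ y ∈ Q, c (w y - m) ^ 2 ≤ ((n : ℝ) * (n + 1) / 2) * ∑ y ∈ Q, ∑ μ, χ y μ * c (w (y + unitVec μ) - w y) ^ 2 := by
    intro c hc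
    have h := sum_sq_sub_avg_le_cube lo n (fun y => c (w y))
    rw [← hQ] at h
    have em : ∀ y, c (w y - m) = c (w y) - avg Q (fun y => c (w y)) := by
      intro y; rw [map_sub, hm, coord_mean_finset Q w c hc]
    simp only [em]
    refine h.trans (le_of_eq ?_)
    congr 1
    refine Finset.sum_congr rfl fun y _ => Finset.sum_congr rfl fun μ _ => ?_
    rw [hite, map_sub]
  have hjk : ∀ j k : Fin N, ∑ y ∈ Q, (((w y - m) j k).re ^ 2 + ((w y - m) j k).im ^ 2)
      ≤ ((n : ℝ) * (n + 1) / 2) * ∑ y ∈ Q, ∑ μ, χ y μ * (((w (y + unitVec μ) - w y) j k).re ^ 2 + ((w (y + unitVec μ) - w y) j k).im ^ 2) := by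
    intro j k
    obtain ⟨⟨cr, hcr⟩, ⟨ci, hci⟩⟩ := Prop7LatticeBoxFriedrichsCov.exists_coord_addMonoidHom (N := N) j k
    have h1 := hcomp cr (fun t A => by
      simp only [hcr, Matrix.smul_apply, smul_eq_mul, Complex.mul_re, Complex.ofReal_re, Complex.ofReal_im]; ring)
    have h2 := hcomp ci (fun t A => by
      simp only [hci, Matrix.smul_apply, smul_eq_mul, Complex.mul_im, Complex.ofReal_re, Complex.ofReal_im]; ring)
    simp only [hcr, hci] at h1 h2
    have e : ∀ (y : Zd d) (μ : Fin d), χ y μ * (((w (y + unitVec μ) - w y) j k).re ^ 2 + ((w (y + unitVec μ) - w y) j k).im ^ 2)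
        = χ y μ * ((w (y + unitVec μ) - w y) j k).re ^ 2 + χ y μ * ((w (y + unitVec μ) - w y) j k).im ^ 2 := fun y μ => by ring
    simp only [e, Finset.sum_add_distrib, mul_add]
    linarith
  have hsum := Finset.sum_le_sum fun j (_ : j ∈ (Finset.univ : Finset (Fin N))) =>
    Finset.sum_le_sum fun k (_ : k ∈ (Finset.univ : Finset (Fin N))) => hjk j k
  have eL : ∑ j : Fin N, ∑ k : Fin N, ∑ y ∈ Q, (((w y - m) j k).re ^ 2 + ((w y - m) j k).im ^ 2)
      = ∑ y ∈ Q, ∑ j : Fin N, ∑ k : Fin N, (((w y - m) j k).re ^ 2 + ((w y - m) j k).im ^ 2) :=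
    sum_sum_sum_comm _ (fun y j k => ((w y - m) j k).re ^ 2 + ((w y - m) j k).im ^ 2)
  have hX : ∑ j : Fin N, ∑ k : Fin N, ∑ y ∈ Q, ∑ μ, χ y μ * (((w (y + unitVec μ) - w y) j k).re ^ 2 + ((w (y + unitVec μ) - w y) j k).im ^ 2)
      = ∑ y ∈ Q, ∑ μ, χ y μ * ∑ j : Fin N, ∑ k : Fin N, (((w (y + unitVec μ) - w y) j k).re ^ 2 + ((w (y + unitVec μ) - w y) j k).im ^ 2) := by
    rw [Prop7LatticeBoxFriedrichsCov.sum_comm4 Q Finset.univ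
      (fun y μ j k => χ y μ * (((w (y + unitVec μ) - w y) j k).re ^ 2 + ((w (y + unitVec μ) - w y) j k).im ^ 2))]
    refine Finset.sum_congr rfl fun y _ => Finset.sum_congr rfl fun μ _ => ?_
    rw [Finset.mul_sum]
    exact Finset.sum_congr rfl fun j _ => by rw [Finset.mul_sum]
  have eR : ∑ j : Fin N, ∑ k : Fin N, (((n : ℝ) * (n + 1) / 2) * ∑ y ∈ Q, ∑ μ, χ y μ * (((w (y + unitVec μ) - w y) j k).re ^ 2 + ((w (y + unitVec μ) - w y) j k).im ^ 2))
      = ((n : ℝ) * (n + 1) / 2) * ∑ y ∈ Q, ∑ μ, χ y μ * ∑ j : Fin N, ∑ k : Fin N, (((w (y + unitVec μ) - w y) j k).re ^ 2 + ((w (y + unitVec μ) - w y) j k).im ^ 2) := by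
    rw [← hX]
    simp only [← Finset.mul_sum]
  rw [eL, eR] at hsum
  have hLow : ∑ y ∈ Q, ‖w y - m‖ ^ 2 ≤ ∑ y ∈ Q, ∑ j : Fin N, ∑ k : Fin N, (((w y - m) j k).re ^ 2 + ((w y - m) j k).im ^ 2) :=
    Finset.sum_le_sum fun y _ => opNorm_sq_le_sum_re_sq_add_im_sq _
  have hUp : ∑ y ∈ Q, ∑ μ, χ y μ * ∑ j : Fin N, ∑ k : Fin N, (((w (y + unitVec μ) - w y) j k).re ^ 2 + ((w (y + unitVec μ) - w y) j k).im ^ 2)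
      ≤ ∑ y ∈ Q, ∑ μ, χ y μ * (N * ‖w (y + unitVec μ) - w y‖ ^ 2) :=
    Finset.sum_le_sum fun y _ => Finset.sum_le_sum fun μ _ => mul_le_mul_of_nonneg_left (sum_re_sq_add_im_sq_le_mul_opNorm_sq _) (hχ0 y μ)
  have hnn : (0 : ℝ) ≤ (n : ℝ) * (n + 1) / 2 := by positivity
  have step := hLow.trans (hsum.trans (mul_le_mul_of_nonneg_left hUp hnn))
  refine step.trans (le_of_eq ?_)
  simp only [hite]
  have : ∀ (y : Zd d) (μ : Fin d), χ y μ * (N * ‖w (y + unitVec μ) - w y‖ ^ 2) = N * (χ y μ * ‖w (y + unitVec μ) - w y‖ ^ 2) := fun y μ => by ring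
  simp only [this, ← Finset.mul_sum]
  ring


/-! ## §4 Small-bond unitary transporters -/

section Covariant

variable [NeZero N]

/-- ★★ **(B9-gen) THE COVARIANT CUBE POINCARÉ INEQUALITY, SMALL-BOND TRANSPORTERS, PLAIN MEAN, ANY SIDE**: `T` unitary with `‖T y μ − 1‖ ≤ β` on the bonds of
`Q = Q(lo,n)`, `w` any `M_N(ℂ)`-valued function:
`Σ_Q‖w y − m‖² ≤ N·(n(n+1)∕2)·(2·Σ_QΣ_μ [y+e_μ ∈ Q]·‖R(T y μ)w(y+e_μ) − w y‖² + 8dβ²·Σ_Q‖w y‖²)`, `m = |Q|⁻¹·Σ_Q w`.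
[cite: Balaban1983RegularityDecay, (2.27) p.580; Balaban1985Averaging, pp.24-25, (56) p.27] -/
theorem sum_sq_sub_mean_le_cube_cov (lo : Zd d) (n : ℕ) {β : ℝ}
    (T : Zd d → Fin d → (Matrix (Fin N) (Fin N) ℂ)ˣ) (hT : ∀ y μ, T y μ ∈ U1 (Matrix (Fin N) (Fin N) ℂ))
    (hTβ : ∀ (y : Zd d) (μ : Fin d), y ∈ Fintype.piFinset (fun i => Finset.Icc (lo i) (lo i + n)) →
      y + unitVec μ ∈ Fintype.piFinset (fun i => Finset.Icc (lo i) (lo i + n)) → ‖(T y μ : Matrix (Fin N) (Fin N) ℂ) - 1‖ ≤ β)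
    (w : Zd d → Matrix (Fin N) (Fin N) ℂ) :
    ∑ y ∈ Fintype.piFinset (fun i => Finset.Icc (lo i) (lo i + n)),
        ‖w y - (((Fintype.piFinset (fun i => Finset.Icc (lo i) (lo i + n))).card : ℝ) : ℂ)⁻¹
          • ∑ x ∈ Fintype.piFinset (fun i => Finset.Icc (lo i) (lo i + n)), w x‖ ^ 2
      ≤ N * ((n : ℝ) * (n + 1) / 2) *
        (2 * ∑ y ∈ Fintype.piFinset (fun i => Finset.Icc (lo i) (lo i + n)), ∑ μ,
            (if y + unitVec μ ∈ Fintype.piFinset (fun i => Finset.Icc (lo i) (lo i + n)) then ‖conjR (T y μ) (w (y + unitVec μ)) - w y‖ ^ 2 else 0)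
          + 8 * d * β ^ 2 * ∑ y ∈ Fintype.piFinset (fun i => Finset.Icc (lo i) (lo i + n)), ‖w y‖ ^ 2) := by
  classical
  set Q := Fintype.piFinset (fun i => Finset.Icc (lo i) (lo i + (n : ℤ))) with hQ
  have hflat := sum_sq_sub_mean_le_cube_matrix lo n w (N := N)
  rw [← hQ] at hflat
  have ht : ∀ y ∈ Q, ∀ μ : Fin d,
      (if y + unitVec μ ∈ Q then ‖w (y + unitVec μ) - w y‖ ^ 2 else (0 : ℝ))
        ≤ 2 * (if y + unitVec μ ∈ Q then ‖conjR (T y μ) (w (y + unitVec μ)) - w y‖ ^ 2 else 0)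
          + 8 * β ^ 2 * (if y + unitVec μ ∈ Q then ‖w (y + unitVec μ)‖ ^ 2 else 0) := by
    intro y hy μ
    split_ifs with hin
    · have hdef : ‖conjR (T y μ) (w (y + unitVec μ)) - w (y + unitVec μ)‖ ≤ 2 * β * ‖w (y + unitVec μ)‖ := by
        calc _ ≤ 2 * ‖(T y μ : Matrix (Fin N) (Fin N) ℂ) - 1‖ * ‖w (y + unitVec μ)‖ := norm_conjR_sub_self_le (hT y μ) _
          _ ≤ 2 * β * ‖w (y + unitVec μ)‖ := by
              have := hTβ y μ (by rw [hQ] at hy; exact hy) (by rw [hQ] at hin; exact hin)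
              have hn' : 0 ≤ ‖w (y + unitVec μ)‖ := norm_nonneg _
              nlinarith
      have hid : w (y + unitVec μ) - w y = (conjR (T y μ) (w (y + unitVec μ)) - w y) - (conjR (T y μ) (w (y + unitVec μ)) - w (y + unitVec μ)) := by abel
      have h1 : ‖w (y + unitVec μ) - w y‖ ≤ ‖conjR (T y μ) (w (y + unitVec μ)) - w y‖ + 2 * β * ‖w (y + unitVec μ)‖ := by
        rw [hid]; exact (norm_sub_le _ _).trans (add_le_add le_rfl hdef)
      have h0 : 0 ≤ ‖w (y + unitVec μ) - w y‖ := norm_nonneg _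
      have h2 := pow_le_pow_left₀ h0 h1 2
      nlinarith [sq_nonneg (‖conjR (T y μ) (w (y + unitVec μ)) - w y‖ - 2 * β * ‖w (y + unitVec μ)‖)]
    · simp
  have hshift : ∑ y ∈ Q, ∑ μ, (if y + unitVec μ ∈ Q then ‖w (y + unitVec μ)‖ ^ 2 else (0 : ℝ)) ≤ d * ∑ y ∈ Q, ‖w y‖ ^ 2 := by
    rw [Finset.sum_comm]
    calc ∑ μ : Fin d, ∑ y ∈ Q, (if y + unitVec μ ∈ Q then ‖w (y + unitVec μ)‖ ^ 2 else (0 : ℝ))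
        ≤ ∑ _μ : Fin d, ∑ y ∈ Q, ‖w y‖ ^ 2 := Finset.sum_le_sum fun μ _ => by
          have := sum_shift_le_of_support Q (H := fun x => if x ∈ Q then ‖w x‖ ^ 2 else 0)
            (fun x => by positivity) (fun x hx => if_neg hx) (unitVec μ)
          exact this.trans (le_of_eq (Finset.sum_congr rfl fun y hy => if_pos hy))
      _ = d * ∑ y ∈ Q, ‖w y‖ ^ 2 := by simp
  have hsum : ∑ y ∈ Q, ∑ μ, (if y + unitVec μ ∈ Q then ‖w (y + unitVec μ) - w y‖ ^ 2 else (0 : ℝ))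
      ≤ 2 * ∑ y ∈ Q, ∑ μ, (if y + unitVec μ ∈ Q then ‖conjR (T y μ) (w (y + unitVec μ)) - w y‖ ^ 2 else 0)
        + 8 * β ^ 2 * (d * ∑ y ∈ Q, ‖w y‖ ^ 2) := by
    calc _ ≤ ∑ y ∈ Q, ∑ μ, (2 * (if y + unitVec μ ∈ Q then ‖conjR (T y μ) (w (y + unitVec μ)) - w y‖ ^ 2 else 0)
          + 8 * β ^ 2 * (if y + unitVec μ ∈ Q then ‖w (y + unitVec μ)‖ ^ 2 else 0)) :=
          Finset.sum_le_sum fun y hy => Finset.sum_le_sum fun μ _ => ht y hy μ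
      _ = 2 * ∑ y ∈ Q, ∑ μ, (if y + unitVec μ ∈ Q then ‖conjR (T y μ) (w (y + unitVec μ)) - w y‖ ^ 2 else 0)
          + 8 * β ^ 2 * ∑ y ∈ Q, ∑ μ, (if y + unitVec μ ∈ Q then ‖w (y + unitVec μ)‖ ^ 2 else (0 : ℝ)) := by
          simp only [Finset.sum_add_distrib, Finset.mul_sum]
      _ ≤ _ := by
          have : 0 ≤ 8 * β ^ 2 := by positivity
          nlinarith [hshift]
  have hnn : (0 : ℝ) ≤ N * ((n : ℝ) * (n + 1) / 2) := by positivity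
  refine hflat.trans ((mul_le_mul_of_nonneg_left hsum hnn).trans (le_of_eq ?_))
  ring

end Covariant

/-! ## §5 From the plaquette bound (the cube axial gauge at the corner `lo`) -/

section Plaq

/-- `l1` of a vector with coordinates in `[0, n]` is at most `d·n`. [folklore] -/
theorem l1_le_of_le_nat {v : Zd d} {n : ℕ} (hv0 : 0 ≤ v) (hv : v ≤ fun _ => (n : ℤ)) : (l1 v : ℝ) ≤ d * n := by
  unfold l1
  push_cast
  calc ∑ κ, ((v κ).natAbs : ℝ) ≤ ∑ _κ : Fin d, (n : ℝ) := Finset.sum_le_sum fun κ _ => by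
          have h0 : 0 ≤ v κ := hv0 κ
          have h1 : v κ ≤ n := hv κ
          have hr : ((v κ).natAbs : ℝ) = ((v κ : ℤ) : ℝ) := by
            rw [Nat.cast_natAbs, Int.cast_abs]
            exact abs_of_nonneg (by exact_mod_cast h0)
          rw [hr]; exact_mod_cast h1
    _ = d * n := by simp

/-- ★ **THE CUBE AXIAL GAUGE HAS SMALL BONDS**: `PlaqSmall V lo (lo+n) α` ⇒ `‖(gaugeAct (axialFn V lo) V) y μ − 1‖ ≤ d·n·α` on the bonds of `Q(lo,n)`.
[cite: Balaban1985Averaging, pp.24-25; Balaban1985RegularSpaces, (1.7) p.77] -/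
theorem norm_axial_sub_one_le_of_plaqSmall_cube [NeZero N] (lo : Zd d) (n : ℕ) {α : ℝ} (hα : 0 ≤ α)
    (V : Zd d → Fin d → (Matrix (Fin N) (Fin N) ℂ)ˣ) (hV : ∀ y μ, V y μ ∈ U1 (Matrix (Fin N) (Fin N) ℂ))
    (hP : PlaqSmall V lo (fun i => lo i + n) α)
    (y : Zd d) (μ : Fin d) (hy : y ∈ Fintype.piFinset (fun i => Finset.Icc (lo i) (lo i + n)))
    (hyμ : y + unitVec μ ∈ Fintype.piFinset (fun i => Finset.Icc (lo i) (lo i + n))) :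
    ‖((gaugeAct (axialFn V lo) V y μ : (Matrix (Fin N) (Fin N) ℂ)ˣ) : Matrix (Fin N) (Fin N) ℂ) - 1‖ ≤ d * n * α := by
  have hy' := (mem_cube_iff lo n).1 hy
  have hyμ' := (mem_cube_iff lo n).1 hyμ
  have hlo : lo ≤ y := fun i => (hy' i).1
  have hhi' : y + B7Prop1Explicit.e μ ≤ fun i => lo i + n := fun i => by
    have := (hyμ' i).2; rwa [← Prop7LatticeBoxFriedrichsCurved.unitVec_eq_e]
  have h := axial_bond_bound_sharp V hV hP lo y μ le_rfl hlo hhi'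
  refine h.trans ?_
  have hv0 : 0 ≤ y - lo := sub_nonneg.2 hlo
  have h1 : (l1 (lowPart μ (y - lo)) : ℝ) ≤ (l1 (y - lo) : ℝ) := by
    have : l1 (lowPart μ (y - lo)) ≤ l1 (y - lo) := by
      rw [B8Lemma1NonAbelian.l1_lowPart_eq]
      unfold l1
      exact Finset.sum_le_sum fun κ _ => by split_ifs <;> simp
    exact_mod_cast this
  have h2 : (l1 (y - lo) : ℝ) ≤ d * n :=
    l1_le_of_le_nat hv0 (fun i => by have := (hy' i).2; simp only [Pi.sub_apply]; linarith)
  nlinarith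

/-- ★★ **(B9-gen) FROM THE PLAQUETTE BOUND**: `V` unitary with `PlaqSmall V lo (lo+n) α`, `u := axialFn V lo`; for every `φ : ℤᵈ → M_N(ℂ)`, with the axial mean
`m_u := |Q|⁻¹·Σ_Q R(u x)φ x`:
`Σ_Q‖φ x − R(u x)⁻¹ m_u‖²` — stated as `Σ_Q‖R(u x)φ x − m_u‖²` — `≤ N·(n(n+1)∕2)·(2·Σ_QΣ_μ[y+e_μ∈Q]‖R(V y μ)φ(y+e_μ) − φ y‖² + 8d(d·n·α)²·Σ_Q‖φ‖²)`.
[cite: Balaban1983RegularityDecay, (2.27) p.580; Balaban1985Averaging, pp.24-25] -/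
theorem sum_sq_sub_mean_le_cube_plaq [NeZero N] (lo : Zd d) (n : ℕ) {α : ℝ} (hα : 0 ≤ α)
    (V : Zd d → Fin d → (Matrix (Fin N) (Fin N) ℂ)ˣ) (hV : ∀ y μ, V y μ ∈ B7Prop2Explicit.unitaryUnits (Matrix (Fin N) (Fin N) ℂ))
    (hP : PlaqSmall V lo (fun i => lo i + n) α) (φ : Zd d → Matrix (Fin N) (Fin N) ℂ) :
    ∑ y ∈ Fintype.piFinset (fun i => Finset.Icc (lo i) (lo i + n)),
        ‖conjR (axialFn V lo y) (φ y) - (((Fintype.piFinset (fun i => Finset.Icc (lo i) (lo i + n))).card : ℝ) : ℂ)⁻¹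
          • ∑ x ∈ Fintype.piFinset (fun i => Finset.Icc (lo i) (lo i + n)), conjR (axialFn V lo x) (φ x)‖ ^ 2
      ≤ N * ((n : ℝ) * (n + 1) / 2) *
        (2 * ∑ y ∈ Fintype.piFinset (fun i => Finset.Icc (lo i) (lo i + n)), ∑ μ,
            (if y + unitVec μ ∈ Fintype.piFinset (fun i => Finset.Icc (lo i) (lo i + n)) then ‖conjR (V y μ) (φ (y + unitVec μ)) - φ y‖ ^ 2 else 0)
          + 8 * d * (d * n * α) ^ 2 * ∑ y ∈ Fintype.piFinset (fun i => Finset.Icc (lo i) (lo i + n)), ‖φ y‖ ^ 2) := by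
  classical
  set u : Zd d → (Matrix (Fin N) (Fin N) ℂ)ˣ := axialFn V lo with hu_def
  have hV1 : ∀ x μ, V x μ ∈ U1 (Matrix (Fin N) (Fin N) ℂ) := fun x μ => mem_U1_of_mem_unitaryUnits (hV x μ)
  have hu1 : ∀ x, u x ∈ U1 (Matrix (Fin N) (Fin N) ℂ) := fun x => mem_U1_of_mem_unitaryUnits (B7Prop2Explicit.hol_mem_of hV _ _)
  have h := sum_sq_sub_mean_le_cube_cov (N := N) lo n (β := d * n * α) (gaugeAct u V) (fun x μ => gaugeAct_mem hV1 hu1 x μ)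
    (fun x μ hx hxμ => norm_axial_sub_one_le_of_plaqSmall_cube lo n hα V hV1 hP x μ hx hxμ) (fun x => conjR (u x) (φ x))
  have e1 : ∀ x, ‖conjR (u x) (φ x)‖ = ‖φ x‖ := fun x => norm_conjR (hu1 x) (φ x)
  have e2 : ∀ (x : Zd d) (μ : Fin d),
      ‖conjR (gaugeAct u V x μ) (conjR (u (x + unitVec μ)) (φ (x + unitVec μ))) - conjR (u x) (φ x)‖
        = ‖conjR (V x μ) (φ (x + unitVec μ)) - φ x‖ := by
    intro x μ
    rw [Prop7LatticeBoxFriedrichsCurved.conjR_gaugeAct_conjR, ← conjR_sub, norm_conjR (hu1 x)]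
  simp only [e1, e2] at h
  exact h

end Plaq

end Summit.QuantumFields.YangMills.Theorems.Prop7LatticeCubePoincareCov
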